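import Literature.AlgebraicGeometry.Motives.AbelianVarietyInducedActionExistence
import Literature.AlgebraicGeometry.Motives.AbelianVarietyInducedActionIsotypical
import HarnessLib

/-!
# Monomial actions `X = Ind_H^G ε ⊗ Y` on abelian varieties: a power permuted by `G` with the stabiliser acting by SIGNS
# `ε : H → ℤˣ` — existence, the induced monomial character, `|H| · dim B_G(X) = (Σ_h ε(h)) dim Y` (so `B_G(X) = 0` for `ε ≠ 1`),
# `|H| · dim B_W(X) = (Σ_h c_W(h) ε(h)) dim Y`, and the isotypical decomposition `B_W(X) ∼ Y^{m_W(ε)}`, `X ∼ ∏_W Y^{m_W(ε)}`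

Sequel of `Motives/AbelianVarietyInducedAction*`.  A MONOMIAL action (Serre §7.1: "When the `W_i` are of dimension 1, the
representation `V` is said to be monomial") on a power `X = ⊕_{t ∈ T} Y` of an abelian variety `Y` over a field `K` (bicone `b`,
`Σ_t π_t ≫ ι_t = 𝟙`, `T` a finite transitive `G`-set, `t₀ ∈ T`, `H = Stab(t₀)`) is an action `ρ : G → End X` permuting the
summands (`ι_t ≫ ρ(g) ≫ π_u = 0` for `u ≠ g t`) whose stabiliser action on `Y_{t₀}` is SCALAR with values `±1`:

  **`ι_{t₀} ≫ ρ(h) ≫ π_{t₀} = ε(h) • 𝟙_Y`**,  `ε : H → ℤˣ` a character   (`hε`),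

i.e. `X = Ind_H^G ε ⊗ Y` — for `ε = 1` the permutation powers `A^{G/H}` of `Motives/AbelianVarietyPermutationPower*`, for `ε` the
sign of a double cover the Prym-type pieces.  This file proves (no definitions; `ε` a hypothesis):

* §1 EXISTENCE (`exists_monomialAction`: Serre Thm. 11 applied to `h ↦ ε(h) • 𝟙_Y`) and the traces
  `Tr(ε(h) • 𝟙 | T_ℓ Y) = ε(h) · 2 dim Y`, `χ_B(ε(h) • 𝟙) = ε(h) · rk Hom(Y, B)`;
* §2 DIMENSIONS over ANY field: the fixed part **`|H| · dim B_G(X) = (Σ_{h ∈ H} ε(h)) · dim Y`**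
  (`card_stabilizer_mul_dim_image_normG_eq`), hence **`B_G(X) = 0` when `ε ≠ 1`** (`dim_image_normG_eq_zero_of_ne_one`:
  `Σ_h ε(h) = 0` for a non-trivial character, Mathlib `sum_hom_units_eq_zero` — "`⟨Ind ε, 1⟩_G = ⟨ε, 1⟩_H = 0`") and
  `dim B_G(X) = dim Y` when `ε = 1`; the isotypical components **`|H| · dim B_W(X) = (Σ_{h ∈ H} c_W(h) ε(h)) · dim Y`**
  (`card_stabilizer_mul_dim_isotypical_eq`; `|G| e_W = Σ_g c_W(g) g`) with the vanishing criterion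
  `B_W(X) = 0 ⟺ dim Y = 0 ∨ Σ_h c_W(h) ε(h) = 0`;
* §3 `Hom`-COUNTS over any field: **`|H| · rk_ℤ Hom(B_W(X), B) = (Σ_h c_W(h) ε(h)) · rk_ℤ Hom(Y, B)`** for every `B`, so with
  `|H| · m_W = Σ_h c_W(h) ε(h)`: `rk Hom(B_W(X), B) = m_W · rk Hom(Y, B)` and, for `Y ≠ 0`, **`Σ_W m_W = |T| = [G : H]`**;
* §4 over a PERFECT field (the tree's Hom-count criterion): **`B_W(Ind_H^G ε ⊗ Y) ∼ Y^{m_W}`** and the ISOTYPICAL DECOMPOSITION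
  **`Ind_H^G ε ⊗ Y ∼ ∏_W Y^{m_W}`** (`isIsogenous_monomial_biproduct_isotypical`).

## References

* [SerreLinearRepresentations1977] J.-P. Serre, *Linear Representations of Finite Groups*, GTM 42 (1977): §3.3 Thm. 11–12, §7.1
  Example ("monomial"), §7.2 Thm. 13, Ex. 7.2; §2.6 Thm. 8.  Held: `book:serre1977-linear-representations-finite-groups`,
  PDF pp. 30–31, 50–52.
* [LangeRodriguez2022] H. Lange, R. E. Rodríguez, *Decomposition of Jacobians by Prym Varieties*, LNM 2310 (2022), §2.9.1
  Thm. 2.9.1 and Prop. 2.9.3 (PDF pp. 43, 46), §3.5.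
* [LangeRecillas2004] H. Lange, S. Recillas, *Abelian varieties with group action*, J. reine angew. Math. 575 (2004), §1 Prop. 1.1.
* [KaniRosen1989] E. Kani, M. Rosen, *Idempotent relations and factors of Jacobians*, Math. Ann. 284 (1989), §2, §3 Thm. B.
* [Milne1986AbelianVarieties] J. S. Milne, *Abelian varieties*, in Cornell–Silverman (1986), §12 p. 122 and Prop. 12.9.
-/

noncomputable section

open CategoryTheory CategoryTheory.Limits MulAction
open Literature.NumberTheory.DiophantineGeometry
open Literature.RepresentationTheory.FiniteGroups

universe u

namespace Literature.AlgebraicGeometry.Motives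

namespace AbelianVariety

namespace Imprimitive

variable {K : Type u} [Field K]

/-! ## §1 Existence of monomial actions and the traces of `ε(h) • 𝟙` -/

section Existence

variable {Y : AbelianVariety K} (B : AbelianVariety K) {T : Type} [Fintype T] (b : Bicone (fun _ : T ↦ Y))
  {G : Type} [Group G] [MulAction G T] (t₀ : T) (ε : stabilizer G t₀ →* ℤˣ)

/-- **Monomial actions exist**: on every power over a transitive `T ∋ t₀` and for every character `ε : Stab(t₀) → ℤˣ` there is
an action permuting the summands with `ι_{t₀} ρ(h) π_{t₀} = ε(h) • 𝟙` — `X = Ind_H^G ε ⊗ Y` (Serre's Thm. 11 for the action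
`h ↦ ε(h) • 𝟙_Y`). [cite: SerreLinearRepresentations1977, §3.3 Thm. 11 and §7.1 Example (monomial representations)] -/
theorem exists_monomialAction [IsPretransitive G T] (hb : ∑ t, b.π t ≫ b.ι t = 𝟙 b.pt) :
    ∃ ρ : G →* End b.pt, (∀ (g : G) (t u : T), g • t ≠ u → b.ι t ≫ End.asHom (ρ g) ≫ b.π u = 0) ∧
      ∀ h : stabilizer G t₀, b.ι t₀ ≫ End.asHom (ρ h) ≫ b.π t₀ = (ε h : ℤ) • 𝟙 Y := by
  let α : stabilizer G t₀ →* End Y :=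
    { toFun := fun h ↦ End.of ((ε h : ℤ) • 𝟙 Y)
      map_one' := by
        change ((ε 1 : ℤˣ) : ℤ) • 𝟙 Y = 𝟙 Y
        rw [map_one, Units.val_one, one_smul]
      map_mul' := fun h h' ↦ by
        change ((ε (h * h') : ℤˣ) : ℤ) • 𝟙 Y = ((ε h' : ℤ) • 𝟙 Y) ≫ ((ε h : ℤ) • 𝟙 Y)
        rw [map_mul, Units.val_mul, Preadditive.zsmul_comp, Preadditive.comp_zsmul, Category.id_comp, smul_smul,
          mul_comm] }
  obtain ⟨ρ, hρ, hα⟩ := exists_inducedAction b t₀ α hb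
  exact ⟨ρ, hρ, fun h ↦ hα h⟩

/-- `Tr(n • 𝟙_Y | T_ℓ Y) = n · 2 dim Y` (`ℓ` invertible in `K`). [cite: MumfordAV1970, §19 Thm. 4 (p. 180)] -/
theorem trace_tateModuleMap_zsmul_id (ℓ : ℕ) [Fact ℓ.Prime] (hℓ : (ℓ : K) ≠ 0) (n : ℤ) :
    LinearMap.trace ℤ_[ℓ] (Y.tateModule ℓ) (tateModuleMap ℓ (n • 𝟙 Y)) = n * ((2 * Y.dim : ℕ) : ℤ_[ℓ]) := by
  rw [tateModuleMap_zsmul, map_zsmul, trace_tateModuleMap_id_eq_two_mul_dim ℓ Y hℓ, zsmul_eq_mul]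

/-- `χ_B(n • 𝟙_Y) = tr_ℤ((n • 𝟙) ∘ − | Hom(Y, B)) = n · rk_ℤ Hom(Y, B)`. [cite: KaniRosen1989, §2] [cite: MumfordAV1970, §19 Thm. 3 (p. 176)] -/
theorem trace_leftComp_zsmul_id (n : ℤ) :
    LinearMap.trace ℤ (Y ⟶ B) (Preadditive.leftComp B (n • 𝟙 Y)).toIntLinearMap = n * Module.finrank ℤ (Y ⟶ B) := by
  haveI : Module.Free ℤ (Y ⟶ B) := module_free_hom_holds Y B
  haveI : Module.Finite ℤ (Y ⟶ B) := module_finite_hom_holds Y B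
  have h : (Preadditive.leftComp B (n • 𝟙 Y)).toIntLinearMap = n • LinearMap.id := by
    refine LinearMap.ext fun f ↦ ?_
    change (n • 𝟙 Y) ≫ f = n • f
    rw [Preadditive.zsmul_comp, Category.id_comp]
  rw [h, map_zsmul, LinearMap.trace_id, zsmul_eq_mul, Int.cast_id]

end Existence

/-! ## §2 Dimensions over any field: `|H| dim B_G(X) = (Σ_h ε(h)) dim Y` and `|H| dim B_W(X) = (Σ_h c_W(h) ε(h)) dim Y` -/

section Dimension

variable {Y : AbelianVariety K} {T : Type} [Fintype T] (b : Bicone (fun _ : T ↦ Y))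
  {G : Type} [Group G] [Fintype G] [MulAction G T] [IsPretransitive G T] (ρ : G →* End b.pt) (t₀ : T)
  [Fintype (stabilizer G t₀)] (ε : stabilizer G t₀ →* ℤˣ)

omit [Fintype (stabilizer G t₀)] in
/-- **The induced monomial character (Serre Thm. 12 for a character of degree one)**:
`|H| · Tr(ρ(g) | T_ℓ X) = 2 dim Y · Σ_{x ∈ G, (x⁻¹gx) t₀ = t₀} ε(x⁻¹ g x)` (`ℓ` invertible in `K`).
[cite: SerreLinearRepresentations1977, §3.3 Thm. 12 and §7.1 Example] -/
theorem card_stabilizer_mul_trace_tateModuleMap_asHom_eq_sum_of_monomial (ℓ : ℕ) [Fact ℓ.Prime] [DecidableEq T]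
    (hb : ∑ t, b.π t ≫ b.ι t = 𝟙 b.pt)
    (hρ : ∀ (g : G) (t u : T), g • t ≠ u → b.ι t ≫ End.asHom (ρ g) ≫ b.π u = 0) (hℓ : (ℓ : K) ≠ 0)
    (hε : ∀ h : stabilizer G t₀, b.ι t₀ ≫ End.asHom (ρ h) ≫ b.π t₀ = (ε h : ℤ) • 𝟙 Y) (g : G) :
    (Nat.card (stabilizer G t₀) : ℤ_[ℓ]) * LinearMap.trace ℤ_[ℓ] (b.pt.tateModule ℓ) (tateModuleMap ℓ (End.asHom (ρ g))) =
      ∑ x : G, if hx : (x⁻¹ * g * x) • t₀ = t₀ then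
        (ε ⟨x⁻¹ * g * x, mem_stabilizer_iff.2 hx⟩ : ℤ) * ((2 * Y.dim : ℕ) : ℤ_[ℓ]) else 0 := by
  rw [card_stabilizer_mul_trace_tateModuleMap_asHom_eq_sum ℓ b ρ hb hρ hℓ t₀ g]
  refine Finset.sum_congr rfl fun x _ ↦ ?_
  by_cases hx : (x⁻¹ * g * x) • t₀ = t₀
  · rw [if_pos hx, dif_pos hx, ← trace_tateModuleMap_zsmul_id ℓ hℓ, ← hε ⟨x⁻¹ * g * x, mem_stabilizer_iff.2 hx⟩]
  · rw [if_neg hx, dif_neg hx]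

/-- **`|H| · dim B_G(Ind_H^G ε ⊗ Y) = (Σ_{h ∈ H} ε(h)) · dim Y`** over any field (`B_G(X) = Im Σ_g ρ(g)`): Frobenius reciprocity
against the unit character, `|H| Σ_g χ_X(g) = |G| Σ_h χ_Y(h) = |G| · 2 dim Y · Σ_h ε(h)`, and `|G| · 2 dim B_G = Σ_g χ_X(g)`.
[cite: SerreLinearRepresentations1977, §7.2 Thm. 13 and Ex. 7.2] [cite: KaniRosen1989, §3 Thm. B] [cite: LangeRodriguez2022, §2.9.1 Prop. 2.9.3 (PDF p. 46)] -/
theorem card_stabilizer_mul_dim_image_normG_eq_of_monomial (hb : ∑ t, b.π t ≫ b.ι t = 𝟙 b.pt)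
    (hρ : ∀ (g : G) (t u : T), g • t ≠ u → b.ι t ≫ End.asHom (ρ g) ≫ b.π u = 0)
    (hε : ∀ h : stabilizer G t₀, b.ι t₀ ≫ End.asHom (ρ h) ≫ b.π t₀ = (ε h : ℤ) • 𝟙 Y)
    {NG : b.pt ⟶ b.pt} (hNG : End.of NG = ∑ g, ρ g) :
    ((Fintype.card (stabilizer G t₀) * (image NG).dim : ℕ) : ℤ) = (∑ h : stabilizer G t₀, (ε h : ℤ)) * Y.dim := by
  obtain ⟨ℓ, hℓp, hℓ⟩ := exists_prime_natCast_ne_zero (K := K)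
  haveI : Fact ℓ.Prime := ⟨hℓp⟩
  obtain ⟨α, hα⟩ := exists_stabilizerAction b ρ hb hρ t₀
  have h1 := card_mul_two_mul_dim_image_normG_eq_sum_trace_tateModuleMap ℓ ρ hNG hℓ
  have h2 := card_stabilizer_mul_sum_trace_eq ℓ b ρ t₀ α hb hρ hℓ hα
  have htr : ∀ h : stabilizer G t₀, LinearMap.trace ℤ_[ℓ] (Y.tateModule ℓ) (tateModuleMap ℓ (End.asHom (α h))) =
      (ε h : ℤ) * ((2 * Y.dim : ℕ) : ℤ_[ℓ]) := fun h ↦ by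
    rw [hα h, hε h, trace_tateModuleMap_zsmul_id ℓ hℓ]
  simp_rw [htr] at h2
  rw [← h1, ← Finset.sum_mul] at h2
  have hG : (Fintype.card G : ℤ_[ℓ]) ≠ 0 := Nat.cast_ne_zero.2 Fintype.card_ne_zero
  have h3 : (((Fintype.card (stabilizer G t₀) * (image NG).dim : ℕ) : ℤ) : ℤ_[ℓ]) * 2 =
      (((∑ h : stabilizer G t₀, (ε h : ℤ)) * Y.dim : ℤ) : ℤ_[ℓ]) * 2 := by
    refine mul_left_cancel₀ hG ?_
    push_cast at h2 ⊢
    linear_combination h2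
  exact_mod_cast (mul_left_injective₀ (two_ne_zero' ℤ_[ℓ]) h3 : _)

/-- **`B_G(Ind_H^G ε ⊗ Y) = 0` for a NON-TRIVIAL sign character** (any field): `Σ_{h ∈ H} ε(h) = 0` (Mathlib
`sum_hom_units_eq_zero`), so `|H| · dim B_G(X) = 0` — "`⟨Ind_H^G ε, 1_G⟩ = ⟨ε, 1_H⟩ = 0`": a monomial action induced from a
non-trivial character has no fixed part (e.g. the Prym-type situation). [cite: SerreLinearRepresentations1977, §7.2 Thm. 13 and Ex. 7.2]
[cite: KaniRosen1989, §3 Thm. B] -/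
theorem dim_image_normG_eq_zero_of_monomial_ne_one (hb : ∑ t, b.π t ≫ b.ι t = 𝟙 b.pt)
    (hρ : ∀ (g : G) (t u : T), g • t ≠ u → b.ι t ≫ End.asHom (ρ g) ≫ b.π u = 0)
    (hε : ∀ h : stabilizer G t₀, b.ι t₀ ≫ End.asHom (ρ h) ≫ b.π t₀ = (ε h : ℤ) • 𝟙 Y) (hε1 : ε ≠ 1)
    {NG : b.pt ⟶ b.pt} (hNG : End.of NG = ∑ g, ρ g) : (image NG).dim = 0 := by
  have hsum : ∑ h : stabilizer G t₀, (ε h : ℤ) = 0 := by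
    have hf : (Units.coeHom ℤ).comp ε ≠ 1 := by
      intro hf
      apply hε1
      ext h
      have := DFunLike.congr_fun hf h
      simpa using this
    simpa using sum_hom_units_eq_zero ((Units.coeHom ℤ).comp ε) hf
  have h := card_stabilizer_mul_dim_image_normG_eq_of_monomial b ρ t₀ ε hb hρ hε hNG
  rw [hsum, zero_mul, Nat.cast_eq_zero, mul_eq_zero] at h
  exact h.resolve_left Fintype.card_ne_zero

/-- **`dim B_G(Ind_H^G 1 ⊗ Y) = dim Y` for the TRIVIAL character** (any field; the permutation power `Y^{G/H}`, Serre Ex. 7.2: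
`⟨Ind_H^G 1, 1⟩ = 1`). [cite: SerreLinearRepresentations1977, §3.3 Example 2 and Ex. 7.2] [cite: KaniRosen1989, §3 Thm. B] -/
theorem dim_image_normG_eq_of_monomial_one (hb : ∑ t, b.π t ≫ b.ι t = 𝟙 b.pt)
    (hρ : ∀ (g : G) (t u : T), g • t ≠ u → b.ι t ≫ End.asHom (ρ g) ≫ b.π u = 0)
    (hε : ∀ h : stabilizer G t₀, b.ι t₀ ≫ End.asHom (ρ h) ≫ b.π t₀ = (ε h : ℤ) • 𝟙 Y) (hε1 : ε = 1)
    {NG : b.pt ⟶ b.pt} (hNG : End.of NG = ∑ g, ρ g) : (image NG).dim = Y.dim := by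
  have h := card_stabilizer_mul_dim_image_normG_eq_of_monomial b ρ t₀ ε hb hρ hε hNG
  subst hε1
  simp only [MonoidHom.one_apply, Units.val_one, Finset.sum_const, Finset.card_univ, nsmul_eq_mul, mul_one,
    Nat.cast_mul] at h
  exact_mod_cast mul_left_cancel₀ (Nat.cast_ne_zero.2 Fintype.card_ne_zero : (Fintype.card (stabilizer G t₀) : ℤ) ≠ 0) h

variable {c : ratCharIdempotents G → G → ℤ}
  (hc : ∀ e : ratCharIdempotents G,
    (Fintype.card G : ℚ) • (e : MonoidAlgebra ℚ G) = ∑ g, (c e g : ℚ) • MonoidAlgebra.of ℚ G g)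
  {u : ratCharIdempotents G → (b.pt ⟶ b.pt)} (hu : ∀ e, End.of (u e) = ∑ g, c e g • ρ g)

include hc hu

/-- **`|H| · dim B_W(Ind_H^G ε ⊗ Y) = (Σ_{h ∈ H} c_W(h) ε(h)) · dim Y`** over any field, for every isotypical component
`B_W(X) = Im u_W`, `u_W = Σ_g c_W(g) ρ(g)` (`|G| e_W = Σ_g c_W(g) g`): "`dim B_W = ½ ⟨ρ_r, W⟩`" with
`⟨Ind_H^G (ε ⊗ χ_Y), |G| e_W⟩_G = ⟨ε ⊗ χ_Y, Res (|G| e_W)⟩_H = 2 dim Y · Σ_h c_W(h) ε(h)`.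
[cite: LangeRodriguez2022, §2.9.1 Thm. 2.9.1 and Prop. 2.9.3 (PDF pp. 43, 46)] [cite: SerreLinearRepresentations1977, §7.2 Thm. 13 and §2.6 Thm. 8] -/
theorem card_stabilizer_mul_dim_isotypical_eq_of_monomial (hb : ∑ t, b.π t ≫ b.ι t = 𝟙 b.pt)
    (hρ : ∀ (g : G) (t u : T), g • t ≠ u → b.ι t ≫ End.asHom (ρ g) ≫ b.π u = 0)
    (hε : ∀ h : stabilizer G t₀, b.ι t₀ ≫ End.asHom (ρ h) ≫ b.π t₀ = (ε h : ℤ) • 𝟙 Y) (e : ratCharIdempotents G) :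
    ((Fintype.card (stabilizer G t₀) * (image (u e)).dim : ℕ) : ℤ) =
      (∑ h : stabilizer G t₀, c e h * (ε h : ℤ)) * Y.dim := by
  obtain ⟨ℓ, hℓp, hℓ⟩ := exists_prime_natCast_ne_zero (K := K)
  haveI : Fact ℓ.Prime := ⟨hℓp⟩
  obtain ⟨α, hα⟩ := exists_stabilizerAction b ρ hb hρ t₀
  have key := card_stabilizer_mul_two_mul_dim_isotypical_eq_sum ℓ b ρ t₀ α hc hu hb hρ hℓ hα e
  have htr : ∀ h : stabilizer G t₀, LinearMap.trace ℤ_[ℓ] (Y.tateModule ℓ) (tateModuleMap ℓ (End.asHom (α h))) =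
      (ε h : ℤ) * ((2 * Y.dim : ℕ) : ℤ_[ℓ]) := fun h ↦ by
    rw [hα h, hε h, trace_tateModuleMap_zsmul_id ℓ hℓ]
  simp_rw [htr, ← mul_assoc] at key
  rw [← Finset.sum_mul] at key
  have key' : (((Fintype.card (stabilizer G t₀) * (image (u e)).dim : ℕ) : ℤ) : ℤ_[ℓ]) * 2 =
      ((((∑ h : stabilizer G t₀, c e h * (ε h : ℤ)) * Y.dim : ℤ)) : ℤ_[ℓ]) * 2 := by
    push_cast at key ⊢
    linear_combination key
  exact_mod_cast (mul_left_injective₀ (two_ne_zero' ℤ_[ℓ]) key' : _)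

/-- **`dim B_W(Ind_H^G ε ⊗ Y) = m · dim Y` whenever `|H| · m = Σ_h c_W(h) ε(h)`** (any field).
[cite: LangeRodriguez2022, §2.9.1 Prop. 2.9.3 (PDF p. 46)] -/
theorem dim_isotypical_eq_of_monomial (hb : ∑ t, b.π t ≫ b.ι t = 𝟙 b.pt)
    (hρ : ∀ (g : G) (t u : T), g • t ≠ u → b.ι t ≫ End.asHom (ρ g) ≫ b.π u = 0)
    (hε : ∀ h : stabilizer G t₀, b.ι t₀ ≫ End.asHom (ρ h) ≫ b.π t₀ = (ε h : ℤ) • 𝟙 Y) (e : ratCharIdempotents G) {m : ℕ}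
    (hm : (Fintype.card (stabilizer G t₀) : ℤ) * m = ∑ h : stabilizer G t₀, c e h * (ε h : ℤ)) :
    (image (u e)).dim = m * Y.dim := by
  have h := card_stabilizer_mul_dim_isotypical_eq_of_monomial b ρ t₀ ε hc hu hb hρ hε e
  rw [← hm, mul_assoc, Nat.cast_mul] at h
  exact_mod_cast mul_left_cancel₀ (Nat.cast_ne_zero.2 Fintype.card_ne_zero : (Fintype.card (stabilizer G t₀) : ℤ) ≠ 0) h

/-- **VANISHING CRITERION `B_W(Ind_H^G ε ⊗ Y) = 0 ⟺ dim Y = 0 ∨ Σ_h c_W(h) ε(h) = 0`** (any field).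
[cite: LangeRodriguez2022, §2.9.1 Thm. 2.9.1 and Prop. 2.9.3 (ii) (PDF pp. 43, 46)] -/
theorem dim_isotypical_eq_zero_iff_of_monomial (hb : ∑ t, b.π t ≫ b.ι t = 𝟙 b.pt)
    (hρ : ∀ (g : G) (t u : T), g • t ≠ u → b.ι t ≫ End.asHom (ρ g) ≫ b.π u = 0)
    (hε : ∀ h : stabilizer G t₀, b.ι t₀ ≫ End.asHom (ρ h) ≫ b.π t₀ = (ε h : ℤ) • 𝟙 Y) (e : ratCharIdempotents G) :
    (image (u e)).dim = 0 ↔ Y.dim = 0 ∨ ∑ h : stabilizer G t₀, c e h * (ε h : ℤ) = 0 := by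
  have h := card_stabilizer_mul_dim_isotypical_eq_of_monomial b ρ t₀ ε hc hu hb hρ hε e
  have hH : (Fintype.card (stabilizer G t₀) : ℤ) ≠ 0 := Nat.cast_ne_zero.2 Fintype.card_ne_zero
  rw [Nat.cast_mul] at h
  constructor
  · intro h0
    rw [h0, Nat.cast_zero, mul_zero] at h
    rcases mul_eq_zero.1 h.symm with h1 | h1
    · exact Or.inr h1
    · exact Or.inl (by exact_mod_cast h1)
  · rintro (h0 | h0)
    · rw [h0, Nat.cast_zero, mul_zero] at h
      exact_mod_cast (mul_eq_zero.1 h).resolve_left hH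
    · rw [h0, zero_mul] at h
      exact_mod_cast (mul_eq_zero.1 h).resolve_left hH

end Dimension

/-! ## §3 `Hom`-counts over any field: `|H| · rk Hom(B_W(X), B) = (Σ_h c_W(h) ε(h)) · rk Hom(Y, B)`, `Σ_W m_W = [G : H]` -/

section HomCounts

variable {Y : AbelianVariety K} (B : AbelianVariety K) {T : Type} [Fintype T] (b : Bicone (fun _ : T ↦ Y))
  {G : Type} [Group G] [Fintype G] [MulAction G T] [IsPretransitive G T] (ρ : G →* End b.pt) (t₀ : T)
  [Fintype (stabilizer G t₀)] (ε : stabilizer G t₀ →* ℤˣ)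
  {c : ratCharIdempotents G → G → ℤ}
  (hc : ∀ e : ratCharIdempotents G,
    (Fintype.card G : ℚ) • (e : MonoidAlgebra ℚ G) = ∑ g, (c e g : ℚ) • MonoidAlgebra.of ℚ G g)
  {u : ratCharIdempotents G → (b.pt ⟶ b.pt)} (hu : ∀ e, End.of (u e) = ∑ g, c e g • ρ g)

include hc hu

/-- **`|H| · rk_ℤ Hom(B_W(Ind_H^G ε ⊗ Y), B) = (Σ_h c_W(h) ε(h)) · rk_ℤ Hom(Y, B)` for every abelian variety `B`** (any field):
the `Hom`-side Frobenius reciprocity (`Motives/AbelianVarietyInducedActionIsotypical`) with `χ_B(ε(h) • 𝟙) = ε(h) rk Hom(Y, B)`.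
[cite: LangeRodriguez2022, §2.9.1 Thm. 2.9.1 and Prop. 2.9.3 (PDF pp. 43, 46)] [cite: KaniRosen1989, §2] [cite: SerreLinearRepresentations1977, §7.2 Thm. 13] -/
theorem card_stabilizer_mul_finrank_hom_isotypical_eq_of_monomial (hb : ∑ t, b.π t ≫ b.ι t = 𝟙 b.pt)
    (hρ : ∀ (g : G) (t u : T), g • t ≠ u → b.ι t ≫ End.asHom (ρ g) ≫ b.π u = 0)
    (hε : ∀ h : stabilizer G t₀, b.ι t₀ ≫ End.asHom (ρ h) ≫ b.π t₀ = (ε h : ℤ) • 𝟙 Y) (e : ratCharIdempotents G) :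
    (Fintype.card (stabilizer G t₀) : ℤ) * Module.finrank ℤ (image (u e) ⟶ B) =
      (∑ h : stabilizer G t₀, c e h * (ε h : ℤ)) * Module.finrank ℤ (Y ⟶ B) := by
  obtain ⟨α, hα⟩ := exists_stabilizerAction b ρ hb hρ t₀
  rw [card_stabilizer_mul_finrank_hom_isotypical_eq_sum B b ρ t₀ α hc hu hb hρ hα e, Finset.sum_mul]
  refine Finset.sum_congr rfl fun h _ ↦ ?_
  rw [hα h, hε h, trace_leftComp_zsmul_id B, mul_assoc]

/-- **`rk_ℤ Hom(B_W(X), B) = m · rk_ℤ Hom(Y, B)` whenever `|H| · m = Σ_h c_W(h) ε(h)`** (any field, every `B`): `B_W(X)` and `Y^m`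
have the same `Hom`-counts. [cite: LangeRodriguez2022, §2.9.1 Prop. 2.9.3 (PDF p. 46)] -/
theorem finrank_hom_isotypical_eq_of_monomial (hb : ∑ t, b.π t ≫ b.ι t = 𝟙 b.pt)
    (hρ : ∀ (g : G) (t u : T), g • t ≠ u → b.ι t ≫ End.asHom (ρ g) ≫ b.π u = 0)
    (hε : ∀ h : stabilizer G t₀, b.ι t₀ ≫ End.asHom (ρ h) ≫ b.π t₀ = (ε h : ℤ) • 𝟙 Y) (e : ratCharIdempotents G)
    {m : ℕ} (hm : (Fintype.card (stabilizer G t₀) : ℤ) * m = ∑ h : stabilizer G t₀, c e h * (ε h : ℤ)) :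
    Module.finrank ℤ (image (u e) ⟶ B) = m * Module.finrank ℤ (Y ⟶ B) := by
  have h := card_stabilizer_mul_finrank_hom_isotypical_eq_of_monomial B b ρ t₀ ε hc hu hb hρ hε e
  rw [← hm, mul_assoc] at h
  exact_mod_cast mul_left_cancel₀ (Nat.cast_ne_zero.2 Fintype.card_ne_zero : (Fintype.card (stabilizer G t₀) : ℤ) ≠ 0) h

/-- **`Σ_W m_W = |T| = [G : H]` for `Y ≠ 0`** (any field): `|T| · rk End Y = rk Hom(X, Y) = Σ_W rk Hom(B_W, Y) = (Σ_W m_W) rk End Y`.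
[cite: LangeRodriguez2022, §2.9.1 Thm. 2.9.1 (b) (PDF p. 43)] [cite: SerreLinearRepresentations1977, §3.3 ("`dim V = (G : H) dim W`")] -/
theorem sum_eq_card_of_monomial (hY : 0 < Y.dim) (hb : ∑ t, b.π t ≫ b.ι t = 𝟙 b.pt)
    (hρ : ∀ (g : G) (t u : T), g • t ≠ u → b.ι t ≫ End.asHom (ρ g) ≫ b.π u = 0)
    (hε : ∀ h : stabilizer G t₀, b.ι t₀ ≫ End.asHom (ρ h) ≫ b.π t₀ = (ε h : ℤ) • 𝟙 Y) {m : ratCharIdempotents G → ℕ}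
    (hm : ∀ e, (Fintype.card (stabilizer G t₀) : ℤ) * m e = ∑ h : stabilizer G t₀, c e h * (ε h : ℤ)) :
    ∑ e, m e = Fintype.card T := by
  have h : Fintype.card T * Module.finrank ℤ (Y ⟶ Y) = (∑ e, m e) * Module.finrank ℤ (Y ⟶ Y) := by
    rw [← finrank_hom_permPower_eq Y b hb, finrank_hom_eq_sum_finrank_hom_isotypical ρ hc hu Y, Finset.sum_mul]
    exact Finset.sum_congr rfl fun e _ ↦ finrank_hom_isotypical_eq_of_monomial Y b ρ t₀ ε hc hu hb hρ hε e (hm e)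
  exact (Nat.eq_of_mul_eq_mul_right (finrank_end_pos hY) h).symm

end HomCounts

/-! ## §4 Over a perfect field: `B_W(Ind_H^G ε ⊗ Y) ∼ Y^{m_W}` and `Ind_H^G ε ⊗ Y ∼ ∏_W Y^{m_W}` -/

section Isogeny

variable [PerfectField K] {Y : AbelianVariety K} {T : Type} [Fintype T] (b : Bicone (fun _ : T ↦ Y))
  {G : Type} [Group G] [Fintype G] [MulAction G T] [IsPretransitive G T] (ρ : G →* End b.pt) (t₀ : T)
  [Fintype (stabilizer G t₀)] (ε : stabilizer G t₀ →* ℤˣ)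
  {c : ratCharIdempotents G → G → ℤ}
  (hc : ∀ e : ratCharIdempotents G,
    (Fintype.card G : ℚ) • (e : MonoidAlgebra ℚ G) = ∑ g, (c e g : ℚ) • MonoidAlgebra.of ℚ G g)
  {u : ratCharIdempotents G → (b.pt ⟶ b.pt)} (hu : ∀ e, End.of (u e) = ∑ g, c e g • ρ g)

include hc hu

/-- **`B_W(Ind_H^G ε ⊗ Y) ∼ Y^m = ⨁_{Fin m} Y` whenever `|H| · m = Σ_h c_W(h) ε(h)`** (perfect field): equal `Hom`-counts into
every `B` (§3) and the tree's criterion `isIsogenous_iff_forall_finrank_hom_eq'`.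
[cite: LangeRodriguez2022, §2.9.1 Thm. 2.9.1 and Prop. 2.9.3 (PDF pp. 43, 46)] [cite: LangeRecillas2004, §1 Prop. 1.1]
[cite: Milne1986AbelianVarieties, §12 p. 122] -/
theorem isIsogenous_isotypical_biproduct_of_monomial (hb : ∑ t, b.π t ≫ b.ι t = 𝟙 b.pt)
    (hρ : ∀ (g : G) (t u : T), g • t ≠ u → b.ι t ≫ End.asHom (ρ g) ≫ b.π u = 0)
    (hε : ∀ h : stabilizer G t₀, b.ι t₀ ≫ End.asHom (ρ h) ≫ b.π t₀ = (ε h : ℤ) • 𝟙 Y) (e : ratCharIdempotents G)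
    {m : ℕ} (hm : (Fintype.card (stabilizer G t₀) : ℤ) * m = ∑ h : stabilizer G t₀, c e h * (ε h : ℤ)) :
    IsIsogenous (image (u e)) (⨁ fun _ : Fin m ↦ Y) := by
  refine isIsogenous_iff_forall_finrank_hom_eq'.2 fun B ↦ ?_
  rw [finrank_hom_isotypical_eq_of_monomial B b ρ t₀ ε hc hu hb hρ hε e hm, finrank_hom_biproduct_const, Fintype.card_fin]

/-- **The ISOTYPICAL DECOMPOSITION of a monomial action: `Ind_H^G ε ⊗ Y ∼ ∏_{W ∈ Irr_ℚ(G)} Y^{m_W}`** with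
`|H| · m_W = Σ_h c_W(h) ε(h)` (perfect field): `X ∼ ∏_W B_W(X)` (the tree's `isIsogenous_biproduct_isotypical`) and `B_W ∼ Y^{m_W}`.
[cite: LangeRodriguez2022, §2.9.1 Thm. 2.9.1 (b) and Prop. 2.9.3 (PDF pp. 43, 46)] [cite: LangeRecillas2004, §1 Prop. 1.1]
[cite: SerreLinearRepresentations1977, §2.6 Thm. 8 and §7.1 Example] -/
theorem isIsogenous_monomial_biproduct_isotypical (hb : ∑ t, b.π t ≫ b.ι t = 𝟙 b.pt)
    (hρ : ∀ (g : G) (t u : T), g • t ≠ u → b.ι t ≫ End.asHom (ρ g) ≫ b.π u = 0)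
    (hε : ∀ h : stabilizer G t₀, b.ι t₀ ≫ End.asHom (ρ h) ≫ b.π t₀ = (ε h : ℤ) • 𝟙 Y) {m : ratCharIdempotents G → ℕ}
    (hm : ∀ e, (Fintype.card (stabilizer G t₀) : ℤ) * m e = ∑ h : stabilizer G t₀, c e h * (ε h : ℤ)) :
    IsIsogenous b.pt (⨁ fun e ↦ ⨁ fun _ : Fin (m e) ↦ Y) := by
  classical
  exact (isIsogenous_biproduct_isotypical ρ hc hu).trans
    (IsIsogenous.biproduct fun e ↦ isIsogenous_isotypical_biproduct_of_monomial b ρ t₀ ε hc hu hb hρ hε e (hm e))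

end Isogeny

end Imprimitive

end AbelianVariety

end Literature.AlgebraicGeometry.Motives
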